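import Literature.Topology.Algebra.CircleNoSmallSubgroups
import Mathlib.Algebra.Category.Grp.Injective
import Mathlib.Topology.Algebra.Nonarchimedean.Basic
import Mathlib.Topology.Algebra.OpenSubgroup
import HarnessLib

/-!
# Extension of continuous unitary characters

Topic `Topology/Algebra`; namespace `Literature.Topology.Algebra`. The character-extension theorem
— a continuous unitary character of a CLOSED subgroup of a locally compact abelian group extends
to the whole group (E. Hewitt, K. A. Ross, *Abstract Harmonic Analysis I* (24.12) [HewittRoss1979];
A. Deitmar, S. Echterhoff, *Principles of Harmonic Analysis*, Cor. 3.6.2) — rests on Pontryagin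
duality, which Mathlib does not have. This file proves, from Mathlib alone, the cases that do NOT
need duality, and which suffice for idele class groups:

* §1 **(E1) abstract groups.** `Additive Circle` is divisible, hence Baer-injective over `ℤ`
  (`divisibleByAdditiveCircle`, `baer_additiveCircle`); a unitary character extends along any
  injective homomorphism of abelian groups (`exists_circleChar_extension_of_injective`), from any
  subgroup (`exists_circleChar_extension`), and in DESCENT form: `χ : B →* S¹` trivial on `B ∩ Γ`
  extends to a character of `G` trivial on `Γ` (`exists_circleChar_extension_trivialOn`).
* §2 **(E2) open subgroups.** A homomorphism agreeing with a continuous one on an open subgroup,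
  or trivial on an open subgroup, is continuous (`continuous_of_eqOn_openSubgroup`,
  `continuous_of_trivial_on_openSubgroup`, any topological monoid target); a continuous unitary
  character of an OPEN subgroup of a topological abelian group extends continuously
  (`exists_continuous_circleChar_extension_of_isOpen`).
* §3 **(E3) nonarchimedean groups.** A continuous unitary character of a subgroup `B` of a
  nonarchimedean group is trivial on `B ∩ V` for some open subgroup `V` (the circle has no small
  subgroups, `Literature.Topology.Algebra.exists_nhds_one_forall_subgroup_le_ker`)
  (`exists_openSubgroup_trivialOn`); hence in a nonarchimedean abelian group a continuous unitary
  character of ANY subgroup extends continuously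
  (`exists_continuous_circleChar_extension_of_nonarchimedean`).
* §4 **(E4) the idele-class shape.** `B ≤ G`, homomorphisms `iN : N →* G` (image in `B`) and
  `iK : K →* G` from topological groups with `(n, k) ↦ iN n · iK k` carrying neighbourhoods of
  `(1,1)` to neighbourhoods of `1` (for `G = C_L = 𝔸_Lˣ/Lˣ`: `N = L_∞ˣ`, `K = ∏_w 𝒪_wˣ`, since
  `L_∞ˣ × ∏_w 𝒪_wˣ` is open in `𝔸_Lˣ` and `𝔸_Lˣ → C_L` is open). SHARP FORM
  `exists_continuous_circleChar_extension_of_nhds_mul_of_trivialOn`: if `χ ∘ iN` is continuous and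
  `χ = 1` on `B ∩ iK(K')` for an open subgroup `K'` of `K`, then `χ` extends continuously to `G`;
  with `K` nonarchimedean, `K'` comes for free from continuity of `χ` on `B ∩ iK(K)`
  (`…_of_nhds_mul`, `…_of_nhds_mul_subgroup`, `…_of_isOpenMap_mul`).

Not proved here: the general closed-subgroup case (e.g. `ℤ ≤ ℝ`), which needs the structure
theory of LCA groups / Pontryagin duality. The algebraic analogue for `Kˣ`-valued characters,
`K` algebraically closed, is `Literature.GroupTheory.exists_monoidHom_extend_of_isAlgClosed`.
Everything is proved (Mathlib only); no global instance is declared.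

## Provenance

Reproduced for the tree under the LEAN-IN-TREE rule (2026-08-18) from the pub-hodgecm cell's
package file `HodgeCM/PerL34/CharExtensionN15.lean` (DAG-node prover #10 lineage, seat pv10,
gate run 20; 363 lines), §§1–4, re-namespaced (`HodgeCM.PerL34.CharExtensionN15` ↦
`Literature.Topology.Algebra`), the two open-subgroup continuity lemmas generalised to any
topological monoid target, docstrings and tags added; §5 (problem-specific restatements) omitted.

## References

* [HewittRoss1979] E. Hewitt, K. A. Ross, *Abstract Harmonic Analysis I*, 2nd ed. (1979), (24.12).
* A. Deitmar, S. Echterhoff, *Principles of Harmonic Analysis*, 2nd ed. (2014), Cor. 3.6.2.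
* C. A. Weibel, *An Introduction to Homological Algebra* (1994), §2.3 (Baer's criterion;
  divisible ⇒ injective) [Weibel1994].
-/

open _root_.Topology Filter Function Set

noncomputable section

namespace Literature.Topology.Algebra

/-! ## §1  (E1) The circle is Baer-injective over `ℤ`; abstract extension and descent -/

/-- The circle group, written additively, is divisible: `x ↦ exp (i x)` is a surjection from the
divisible group `ℝ` (a `def`, not a global instance). [folklore] -/
@[reducible] def divisibleByAdditiveCircle : DivisibleBy (Additive Circle) ℤ :=
  Function.Surjective.divisibleBy (f := Circle.expHom)
    (fun z => by
      obtain ⟨x, hx⟩ := Circle.exp_surjective (Additive.toMul z)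
      exact ⟨x, by simpa [Circle.expHom] using congrArg Additive.ofMul hx⟩)
    (fun a n => map_zsmul Circle.expHom n a)

/-- Baer's criterion for the additive circle: `Additive Circle` is an injective `ℤ`-module
(divisible abelian groups are injective). [cite: Weibel1994, Cor. 2.3.2] -/
theorem baer_additiveCircle : Module.Baer ℤ (Additive Circle) :=
  @Module.Baer.of_divisible _ _ divisibleByAdditiveCircle

/-- **(E1)** A unitary character extends along any injective homomorphism of abelian groups.
[cite: HewittRoss1979, (24.12) (discrete case)] -/
theorem exists_circleChar_extension_of_injective {A B : Type*} [CommGroup A] [CommGroup B]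
    (f : A →* B) (hf : Injective f) (χ : A →* Circle) :
    ∃ χ' : B →* Circle, ∀ a : A, χ' (f a) = χ a := by
  obtain ⟨h, hh⟩ := baer_additiveCircle.extension_property_addMonoidHom
    (MonoidHom.toAdditive f) hf (MonoidHom.toAdditive χ)
  refine ⟨MonoidHom.toAdditive.symm h, fun a => ?_⟩
  have := DFunLike.congr_fun hh (Additive.ofMul a)
  simpa [MonoidHom.toAdditive] using congrArg Additive.toMul this

/-- **(E1), subgroup form**: a unitary character of a subgroup of an abelian group extends to the
group. [cite: HewittRoss1979, (24.12) (discrete case)] -/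
theorem exists_circleChar_extension {G : Type*} [CommGroup G] (B : Subgroup G)
    (χ : B →* Circle) : ∃ χ' : G →* Circle, ∀ b : B, χ' (b : G) = χ b :=
  exists_circleChar_extension_of_injective B.subtype B.subtype_injective χ

/-- **(E1), descent form**: if `χ : B →* S¹` is trivial on `B ∩ Γ`, it is the restriction of a
character of `G` that is trivial on `Γ` (extend the descended character of `B / (B ∩ Γ) ↪ G / Γ`
and pull back). [folklore] -/
theorem exists_circleChar_extension_trivialOn {G : Type*} [CommGroup G] (B Γ : Subgroup G)
    (χ : B →* Circle) (hχ : ∀ b : B, (b : G) ∈ Γ → χ b = 1) :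
    ∃ χ' : G →* Circle, (∀ γ ∈ Γ, χ' γ = 1) ∧ ∀ b : B, χ' (b : G) = χ b := by
  let π : G →* G ⧸ Γ := QuotientGroup.mk' Γ
  let φ : B →* G ⧸ Γ := π.comp B.subtype
  have hφker : φ.ker ≤ χ.ker := by
    intro b hb
    rw [MonoidHom.mem_ker] at hb ⊢
    have hb' : (b : G) ∈ Γ := by
      rw [← QuotientGroup.ker_mk' Γ]
      exact hb
    exact hχ b hb'
  -- `χ` descends to `B ⧸ ker φ`, which embeds into `G ⧸ Γ`; extend there (E1) and pull back.
  let χK : B ⧸ φ.ker →* Circle := QuotientGroup.lift φ.ker χ hφker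
  let ι : B ⧸ φ.ker →* G ⧸ Γ := QuotientGroup.kerLift φ
  obtain ⟨χbar, hχbar⟩ :=
    exists_circleChar_extension_of_injective ι (QuotientGroup.kerLift_injective φ) χK
  refine ⟨χbar.comp π, fun γ hγ => ?_, fun b => ?_⟩
  · have : π γ = 1 := by
      rw [← MonoidHom.mem_ker, QuotientGroup.ker_mk']
      exact hγ
    simp [this]
  · have h1 : (χbar.comp π) (b : G) = χbar (ι (QuotientGroup.mk b)) := by
      simp [ι, φ, π, QuotientGroup.kerLift_mk]
    rw [h1, hχbar, show χK (QuotientGroup.mk b) = χ b from QuotientGroup.lift_mk' _ hφker b]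

/-! ## §2  (E2) Extension from an open subgroup -/

section Open

variable {G : Type*} [Group G] [TopologicalSpace G] [IsTopologicalGroup G]
  {M : Type*} [Monoid M] [TopologicalSpace M] [ContinuousMul M]

/-- A homomorphism of a topological group into a topological monoid that agrees with a
continuous homomorphism on an open subgroup is continuous. [folklore] -/
theorem continuous_of_eqOn_openSubgroup (H : Subgroup G) (hH : IsOpen (H : Set G))
    (χ : H →* M) (hχ : Continuous χ) (χ' : G →* M) (hext : ∀ h : H, χ' (h : G) = χ h) :
    Continuous χ' := by
  apply continuous_of_continuousAt_one χ'
  have hon : ContinuousOn χ' (H : Set G) := by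
    rw [continuousOn_iff_continuous_restrict]
    have : (H : Set G).restrict χ' = fun h : H => χ h := funext fun h => hext h
    rw [this]
    exact hχ
  exact hon.continuousAt (hH.mem_nhds H.one_mem)

/-- A homomorphism of a topological group into a topological monoid which is trivial on an open
subgroup is continuous. [folklore] -/
theorem continuous_of_trivial_on_openSubgroup (V : OpenSubgroup G) (χ' : G →* M)
    (hV : ∀ v ∈ (V : Set G), χ' v = 1) : Continuous χ' := by
  apply continuous_of_continuousAt_one χ'
  have hev : (fun g => χ' g) =ᶠ[𝓝 (1 : G)] fun _ => (1 : M) := by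
    filter_upwards [V.isOpen.mem_nhds V.one_mem] with g hg
    exact hV g hg
  rw [ContinuousAt, map_one]
  exact tendsto_const_nhds.congr' hev.symm

/-- **(E2)** A continuous unitary character of an OPEN subgroup of a topological abelian group
extends to a continuous unitary character of the group. [cite: HewittRoss1979, (24.12)] -/
theorem exists_continuous_circleChar_extension_of_isOpen {G : Type*} [CommGroup G]
    [TopologicalSpace G] [IsTopologicalGroup G] (H : Subgroup G) (hH : IsOpen (H : Set G))
    (χ : H →* Circle) (hχ : Continuous χ) :
    ∃ χ' : G →* Circle, Continuous χ' ∧ ∀ h : H, χ' (h : G) = χ h := by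
  obtain ⟨χ', hext⟩ := exists_circleChar_extension H χ
  exact ⟨χ', continuous_of_eqOn_openSubgroup H hH χ hχ χ' hext, hext⟩

end Open

/-! ## §3  (E3) Nonarchimedean groups: extension from an arbitrary subgroup -/

section Nonarchimedean

/-- No small subgroups, relative form: a continuous unitary character of a subgroup `B` of a
nonarchimedean group (not necessarily abelian) is trivial on `B ∩ V` for some open subgroup `V`
of the ambient group. [folklore] -/
theorem exists_openSubgroup_trivialOn {G : Type*} [Group G] [TopologicalSpace G]
    [NonarchimedeanGroup G] (B : Subgroup G) (χ : B →* Circle) (hχ : Continuous χ) :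
    ∃ V : OpenSubgroup G, ∀ b : B, (b : G) ∈ (V : Set G) → χ b = 1 := by
  obtain ⟨U, hU, hker⟩ := exists_nhds_one_forall_subgroup_le_ker χ hχ
  rw [nhds_subtype_eq_comap] at hU
  obtain ⟨U', hU', hsub⟩ := hU
  obtain ⟨V, hV⟩ := NonarchimedeanGroup.is_nonarchimedean U' (by simpa using hU')
  refine ⟨V, fun b hb => ?_⟩
  have hle : (V : Subgroup G).comap B.subtype ≤ χ.ker := by
    apply hker
    intro x hx
    exact hsub (hV hx)
  exact hle (show b ∈ (V : Subgroup G).comap B.subtype from hb)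

variable {G : Type*} [CommGroup G] [TopologicalSpace G] [NonarchimedeanGroup G]

/-- **(E3)** In a nonarchimedean topological abelian group, a continuous unitary character of
ANY subgroup extends to a continuous unitary character of the group (trivial on an open
subgroup meeting the given subgroup inside the kernel, hence continuous).
[cite: HewittRoss1979, (24.12)] -/
theorem exists_continuous_circleChar_extension_of_nonarchimedean (B : Subgroup G)
    (χ : B →* Circle) (hχ : Continuous χ) :
    ∃ χ' : G →* Circle, Continuous χ' ∧ ∀ b : B, χ' (b : G) = χ b := by
  obtain ⟨V, hV⟩ := exists_openSubgroup_trivialOn B χ hχ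
  obtain ⟨χ', htriv, hext⟩ := exists_circleChar_extension_trivialOn B (V : Subgroup G) χ hV
  exact ⟨χ', continuous_of_trivial_on_openSubgroup V χ' (fun v hv => htriv v hv), hext⟩

end Nonarchimedean

/-! ## §4  (E4) The idele-class shape

`G` any topological abelian group (think `C_L = 𝔸_Lˣ/Lˣ`), `B ≤ G` the subgroup carrying the
prescribed character, `iN : N →* G` with image in `B` (think: `L_∞ˣ`) and `iK : K →* G` with `K`
nonarchimedean (think: `∏_w 𝒪_wˣ`), such that `N × K → G`, `(n, k) ↦ iN n · iK k`, maps
neighbourhoods of `(1,1)` to neighbourhoods of `1`. No local compactness, closedness or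
separation is used. -/

section IdeleShape

variable {G : Type*} [CommGroup G] [TopologicalSpace G] [IsTopologicalGroup G]
variable {N K : Type*} [Group N] [TopologicalSpace N] [Group K] [TopologicalSpace K]

/-- **(E4), sharp form.** `B ≤ G`; `iN : N →* G` with image in `B` and `iK : K →* G` ANY
homomorphisms from topological groups such that `(n, k) ↦ iN n · iK k : N × K → G` carries
neighbourhoods of `(1,1)` to neighbourhoods of `1`. A unitary character `χ` of `B` whose pull-back
to `N` is continuous and which is trivial on `B ∩ iK(K')` for some open subgroup `K'` of `K`
extends to a continuous unitary character of `G` (and is therefore itself continuous on `B`).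
[folklore] -/
theorem exists_continuous_circleChar_extension_of_nhds_mul_of_trivialOn (B : Subgroup G)
    (iN : N →* G) (iK : K →* G) (hNB : ∀ n, iN n ∈ B)
    (hm : ∀ s ∈ 𝓝 ((1 : N), (1 : K)), (fun p : N × K => iN p.1 * iK p.2) '' s ∈ 𝓝 (1 : G))
    (χ : B →* Circle) (hχN : Continuous fun n : N => χ ⟨iN n, hNB n⟩)
    (K' : OpenSubgroup K) (hK' : ∀ b : B, (b : G) ∈ (K' : Subgroup K).map iK → χ b = 1) :
    ∃ χ' : G →* Circle, Continuous χ' ∧ ∀ b : B, χ' (b : G) = χ b := by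
  -- (E1, descent): extend `χ` to an abstract character of `G` trivial on `iK(K')`.
  let Γ : Subgroup G := (K' : Subgroup K).map iK
  obtain ⟨χ', htriv, hext⟩ := exists_circleChar_extension_trivialOn B Γ χ hK'
  refine ⟨χ', ?_, hext⟩
  -- continuity at 1: near `1`, `g = iN n · iK k` with `n` near `1` and `k ∈ K'`.
  apply continuous_of_continuousAt_one χ'
  rw [ContinuousAt, map_one, tendsto_def]
  intro A hA
  -- the pull-back of `χ` to `N`, as a homomorphism
  let χN : N →* Circle :=
    { toFun := fun n => χ ⟨iN n, hNB n⟩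
      map_one' := by
        have : (⟨iN 1, hNB 1⟩ : B) = 1 := Subtype.ext (by simp)
        rw [this, map_one]
      map_mul' := fun x y => by
        have : (⟨iN (x * y), hNB (x * y)⟩ : B) = ⟨iN x, hNB x⟩ * ⟨iN y, hNB y⟩ :=
          Subtype.ext (by simp)
        rw [this, map_mul] }
  have hχN' : Continuous χN := hχN
  -- the neighbourhood `s = {(n,k) : χ n ∈ A, k ∈ K'}` of `(1,1)` in `N × K`
  let s : Set (N × K) := (fun p => χN p.1) ⁻¹' A ∩ (fun p => p.2) ⁻¹' (K' : Set K)
  have hs : s ∈ 𝓝 ((1 : N), (1 : K)) := by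
    refine Filter.inter_mem ?_ ?_
    · have hc : Continuous fun p : N × K => χN p.1 := hχN'.comp continuous_fst
      exact hc.continuousAt.preimage_mem_nhds (by simpa using hA)
    · exact continuous_snd.continuousAt.preimage_mem_nhds (K'.isOpen.mem_nhds K'.one_mem)
  refine Filter.mem_of_superset (hm s hs) ?_
  rintro g ⟨⟨n, k⟩, ⟨hnA, hkK'⟩, rfl⟩
  -- `χ' (iN n · iK k) = χ' (iN n) · χ' (iK k) = χ n · 1`
  have hn : χ' (iN n) = χN n := hext ⟨iN n, hNB n⟩
  have hk : χ' (iK k) = 1 := htriv _ (Subgroup.mem_map.mpr ⟨k, hkK', rfl⟩)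
  show χ' (iN n * iK k) ∈ A
  rw [map_mul, hn, hk, mul_one]
  exact hnA

/-- **(E4)** The same with `K` NONARCHIMEDEAN and `χ` continuous on `B ∩ iK(K)` (pulled back to
`K`): the open subgroup `K'` of the sharp form exists because the circle has no small subgroups.
[folklore] -/
theorem exists_continuous_circleChar_extension_of_nhds_mul [NonarchimedeanGroup K]
    (B : Subgroup G) (iN : N →* G) (iK : K →* G) (hNB : ∀ n, iN n ∈ B)
    (hm : ∀ s ∈ 𝓝 ((1 : N), (1 : K)), (fun p : N × K => iN p.1 * iK p.2) '' s ∈ 𝓝 (1 : G))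
    (χ : B →* Circle) (hχN : Continuous fun n : N => χ ⟨iN n, hNB n⟩)
    (hχK : Continuous fun k : B.comap iK => χ ⟨iK k, k.2⟩) :
    ∃ χ' : G →* Circle, Continuous χ' ∧ ∀ b : B, χ' (b : G) = χ b := by
  -- (no small subgroups inside `K`): an open subgroup `K'` of `K` with `χ = 1` on `B ∩ iK(K')`.
  let BK : Subgroup K := B.comap iK
  let χK : BK →* Circle := χ.comp (iK.subgroupComap B)
  have hχK' : Continuous χK := hχK
  obtain ⟨K', hK'⟩ := exists_openSubgroup_trivialOn (G := K) BK χK hχK'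
  have hχΓ : ∀ b : B, (b : G) ∈ (K' : Subgroup K).map iK → χ b = 1 := by
    intro b hb
    obtain ⟨k, hk, hkb⟩ := Subgroup.mem_map.mp hb
    have hkB : iK k ∈ B := by rw [hkb]; exact b.2
    have h := hK' ⟨k, hkB⟩ hk
    have heq : χK ⟨k, hkB⟩ = χ b := by
      show χ ((iK.subgroupComap B) ⟨k, hkB⟩) = χ b
      congr 1
      exact Subtype.ext hkb
    rw [heq] at h
    exact h
  exact exists_continuous_circleChar_extension_of_nhds_mul_of_trivialOn B iN iK hNB hm χ hχN K' hχΓ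

/-- **(E4), subgroup form.** `N₀ ≤ B` and `K₀ ≤ G` subgroups (subspace topologies), `K₀`
nonarchimedean, `(n, k) ↦ n k` carrying neighbourhoods of `(1,1)` to neighbourhoods of `1`, `χ`
continuous on `B`. [folklore] -/
theorem exists_continuous_circleChar_extension_of_nhds_mul_subgroup (B N₀ K₀ : Subgroup G)
    (hNB : N₀ ≤ B) [NonarchimedeanGroup K₀]
    (hm : ∀ s ∈ 𝓝 ((1 : N₀), (1 : K₀)),
      (fun p : N₀ × K₀ => (p.1 : G) * (p.2 : G)) '' s ∈ 𝓝 (1 : G))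
    (χ : B →* Circle) (hχ : Continuous χ) :
    ∃ χ' : G →* Circle, Continuous χ' ∧ ∀ b : B, χ' (b : G) = χ b := by
  refine exists_continuous_circleChar_extension_of_nhds_mul B N₀.subtype K₀.subtype
    (fun n => hNB n.2) (by simpa using hm) χ ?_ ?_
  · exact hχ.comp (by exact Continuous.subtype_mk continuous_subtype_val _)
  · exact hχ.comp (by
      exact Continuous.subtype_mk (continuous_subtype_val.comp continuous_subtype_val) _)

/-- **(E4), open-map form**: `iN × iK` followed by multiplication is an OPEN MAP `N × K → G`
(for ideles: `L_∞ˣ × ∏_w 𝒪_wˣ` is open in `𝔸_Lˣ` and `𝔸_Lˣ → C_L` is open), `K`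
nonarchimedean. [folklore] -/
theorem exists_continuous_circleChar_extension_of_isOpenMap_mul [NonarchimedeanGroup K]
    (B : Subgroup G) (iN : N →* G) (iK : K →* G) (hNB : ∀ n, iN n ∈ B)
    (hm : IsOpenMap fun p : N × K => iN p.1 * iK p.2)
    (χ : B →* Circle) (hχN : Continuous fun n : N => χ ⟨iN n, hNB n⟩)
    (hχK : Continuous fun k : B.comap iK => χ ⟨iK k, k.2⟩) :
    ∃ χ' : G →* Circle, Continuous χ' ∧ ∀ b : B, χ' (b : G) = χ b :=
  exists_continuous_circleChar_extension_of_nhds_mul B iN iK hNB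
    (fun s hs => by simpa using hm.image_mem_nhds hs) χ hχN hχK

end IdeleShape

end Literature.Topology.Algebra
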